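import Literature.NumberTheory.EllipticCurves.ZpExtensionEisensteinOrdinaryCoreIsotropyProofs
import Literature.NumberTheory.EllipticCurves.LocalKernelOfReductionGaloisTransportProofs
import HarnessLib

/-!
# H.4 at `v ∣ p`, isotropy of the strict ordinary cores, for the CANONICAL conjugation datum `ofLifts` — no place-compatibility
# hypothesis left (assembly; theorems only, no definition, no named fact, no instance, no `sorry`)

Topic `NumberTheory/EllipticCurves` (cell `pub/bsd-print-x9`, D1 road; memo `HOME/p1/H4-AT-P-PLAN` (E1)+(E2)+(A1) fully assembled for
`E = W ⊗ K`, `W/ℚ`, `K` a number field with an involution `σ` and an involutive lift `τ` of it to `K̄`).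

`ZpExtensionEisensteinOrdinaryCoreIsotropyProofs` proves the isotropy of the strict ordinary cores of Howard's `F_𝔮` at a good ordinary
`v ∣ p` under ONE non-arithmetic hypothesis `hθδ`: «`θ ∘ δ_v` carries `Fil_{σ v} E[p^k]` into `Fil_v E[p^k]`».  For the conjugation
datum `Howard2004.ConjugationDatum.ofLifts σ … τ …` (lit/x9-p1-w4) and `θ = hτ.torsionMap W (p^k)` (the action of `τ` on `E[p^k]`) this
hypothesis is the theorem `WeierstrassCurve.torsionMap_delta_apply_mem_torsionFilAt` of `LocalKernelOfReductionGaloisTransportProofs`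
(`E₁(K̄_v)` is canonical). Whence:

* **`WeierstrassCurve.isotropic_ordinaryCore_ofLifts`** — at `v ∋ p` with `HasGoodReductionAt v` and `p ∤ a_v`, for the level-`k`
  Eisenstein duality datum built from `ẽ = conjPairing e (hτ.torsionMap W (p^k)) log` (`e(a, a) = 0`): both «`→`» clauses of
  `DualityDatum.IsSelfOrthogonalAt` hold for the strict ordinary cores `(ordinaryFiltrationAt ·).ordinaryCore hm k` at `v` and `σ • v`
  (Howard, Lemma 3.1.1: «`Fil_v T_𝔮` is its own exact orthogonal complement» — the isotropy half, at finite level).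

References: [Howard2004HeegnerKolyvagin] §1.3 H.4 and Rem. 1.3.2, Lemma 3.1.1, Def. 3.2.6 (arXiv:1202.6340 p. 7 L33–90, p. 15 L56–62,
p. 16 L108–110); [GreenbergLNM1716] §1 p. 62; [SilvermanAEC2009] III.8.1, VII.1.3(b), VII.2.1–2.2. BSD is not proved by any of this.
-/

noncomputable section

open scoped ContRepresentation
open NumberField IsDedekindDomain Field

namespace WeierstrassCurve

open Literature.NumberTheory.EllipticCurves Literature.NumberTheory.GaloisRepresentations
  Literature.NumberTheory.GaloisCohomology.Howard2004 Literature.NumberTheory.EllipticCurves.ZpExtension IwasawaAlgebra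

variable {K : Type} [Field K] [NumberField K] (W : WeierstrassCurve ℚ) [W.IsElliptic] {p : ℕ} [hp : Fact p.Prime] {m : ℕ}
  (hm : 1 ≤ m) (k : ℕ) (σ : K ≃ₐ[ℚ] K) (hσ₁ : σ ≠ 1) (hσ : σ * σ = 1) (τ : AlgebraicClosure K ≃+* AlgebraicClosure K)
  (hτ : IsLiftOfAut σ τ) (hτ₂ : Function.Involutive τ) (κ : ZpExtension K p)
  (t : ∀ j, ((W.baseChange K).torsionGaloisModule ((p : ℤ) ^ (j + 1))).toContRepresentation →ⁱL
    ((W.baseChange K).torsionGaloisModule ((p : ℤ) ^ j)).toContRepresentation)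
  (ht : ∀ j (P : geomTorsion (W.baseChange K) ((p : ℤ) ^ (j + 1))), t j P = (W.baseChange K).geomTorsionReduce p j P)
  (e : geomTorsion (W.baseChange K) ((p : ℤ) ^ k) →+ geomTorsion (W.baseChange K) ((p : ℤ) ^ k) →+
    DiscreteGaloisModule.MuCarrier K (p ^ k))
  (log : DiscreteGaloisModule.MuCarrier K (p ^ k) →+ ZMod (p ^ k))
  (hsymm : ∀ a b, conjPairing e (hτ.torsionMap W ((p : ℤ) ^ k)) log a b = conjPairing e (hτ.torsionMap W ((p : ℤ) ^ k)) log b a)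
  (hequiv : ∀ (g : absoluteGaloisGroup K) (a b : geomTorsion (W.baseChange K) ((p : ℤ) ^ k)),
    conjPairing e (hτ.torsionMap W ((p : ℤ) ^ k)) log ((W.baseChange K).torsionGaloisModule _ g a)
        ((W.baseChange K).torsionGaloisModule _ ((ConjugationDatum.ofLifts σ hσ₁ hσ τ hτ hτ₂).conj g) b) =
      cyclotomicCharacterModPow K p k g * conjPairing e (hτ.torsionMap W ((p : ℤ) ^ k)) log a b)
  (hnd : ∀ w, (∀ b, conjPairing e (hτ.torsionMap W ((p : ℤ) ^ k)) log w b = 0) → w = 0)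
  (hex : ∀ φ : geomTorsion (W.baseChange K) ((p : ℤ) ^ k) →+ ZMod (p ^ k), ∃ w, ∀ b,
    conjPairing e (hτ.torsionMap W ((p : ℤ) ^ k)) log w b = φ b)
  (hκ : ∀ g : absoluteGaloisGroup K,
    p ^ eisensteinLevel (p := p) hm k ∣ κ.twistExponent (eisensteinLevel (p := p) hm k) g +
      κ.twistExponent (eisensteinLevel (p := p) hm k) ((ConjugationDatum.ofLifts σ hσ₁ hσ τ hτ hτ₂).conj g))

/-- **Howard's H.4 at `v ∣ p`, isotropy half, for `E = W ⊗ K` and the canonical conjugation datum.** At a place `v ∋ p` of good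
ordinary reduction (`p ∤ a_v`), for the Eisenstein duality datum of level `k` built from `(s, t) ↦ log e(s, τ t)` with `e(a, a) = 0`
(the Weil pairing), the strict ordinary core of `F_𝔮` at `v` and the transport of the one at `v̄ = σ • v` annihilate each other under
the induced local pairing — with NO residual hypothesis on the places (`E₁(K̄_v)` is canonical:
`torsionMap_delta_apply_mem_torsionFilAt`). [cite: Howard2004HeegnerKolyvagin, H.4, Rem. 1.3.2, Lemma 3.1.1 and Def. 3.2.6 (arXiv p. 7 L69–90, p. 15 L60–62, p. 16 L108–110)]
[cite: GreenbergLNM1716, §1 p. 62] [cite: SilvermanAEC2009, Prop. VII.1.3(b) and Props. VII.2.1–2.2] -/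
theorem isotropic_ordinaryCore_ofLifts (v : HeightOneSpectrum (𝓞 K)) (hgood : (W.baseChange K).HasGoodReductionAt v)
    (hpv : (p : 𝓞 K) ∈ v.asIdeal) (hord : ¬ ((p : ℤ) ∣ (W.baseChange K).frobeniusTraceAt v)) (hself : ∀ a, e a a = 0) :
    (∀ x ∈ ((W.baseChange K).ordinaryFiltrationAt v t ht).ordinaryCore hm k,
      ∀ y ∈ (((W.baseChange K).ordinaryFiltrationAt ((ConjugationDatum.ofLifts σ hσ₁ hσ τ hτ hτ₂).σ • v) t ht).ordinaryCore
          hm k).map ((ConjugationDatum.ofLifts σ hσ₁ hσ τ hτ hτ₂).transportH1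
            (κ.eisensteinTwist ((W.baseChange K).torsionGaloisModule ((p : ℤ) ^ k)) hm k) v),
        (eisensteinDualityDatum hm k (ConjugationDatum.ofLifts σ hσ₁ hσ τ hτ hτ₂) κ
          ((W.baseChange K).torsionGaloisModule ((p : ℤ) ^ k)) (conjPairing e (hτ.torsionMap W ((p : ℤ) ^ k)) log) hsymm
          hequiv hnd hex hκ).localCup (Sum.inr v) x y = 0) ∧
    (∀ y ∈ (((W.baseChange K).ordinaryFiltrationAt ((ConjugationDatum.ofLifts σ hσ₁ hσ τ hτ hτ₂).σ • v) t ht).ordinaryCore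
          hm k).map ((ConjugationDatum.ofLifts σ hσ₁ hσ τ hτ hτ₂).transportH1
            (κ.eisensteinTwist ((W.baseChange K).torsionGaloisModule ((p : ℤ) ^ k)) hm k) v),
      ∀ x ∈ ((W.baseChange K).ordinaryFiltrationAt v t ht).ordinaryCore hm k,
        (eisensteinDualityDatum hm k (ConjugationDatum.ofLifts σ hσ₁ hσ τ hτ hτ₂) κ
          ((W.baseChange K).torsionGaloisModule ((p : ℤ) ^ k)) (conjPairing e (hτ.torsionMap W ((p : ℤ) ^ k)) log) hsymm
          hequiv hnd hex hκ).localCup (Sum.inr v) x y = 0) := by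
  haveI : CharZero ((σ • v).adicCompletion K) := charZero_of_injective_algebraMap (algebraMap K _).injective
  haveI : CharZero (v.adicCompletion K) := charZero_of_injective_algebraMap (algebraMap K _).injective
  exact (W.baseChange K).isotropic_ordinaryCore_of_not_dvd_frobeniusTraceAt hm k (ConjugationDatum.ofLifts σ hσ₁ hσ τ hτ hτ₂) κ
    t ht e (hτ.torsionMap W ((p : ℤ) ^ k)) log hsymm hequiv hnd hex hκ v hgood hpv hord hself
    (fun a' ha' ↦ W.torsionMap_delta_apply_mem_torsionFilAt σ hσ₁ hσ τ hτ hτ₂ v ((p : ℤ) ^ k) ha')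

end WeierstrassCurve

end
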